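import Summits.HodgeConjecture.HodgeConjecture.Statement
import Literature.AlgebraicGeometry.HodgeTheory.AlgebraicClassesPullbackOfCupProduct
import Literature.AlgebraicGeometry.HodgeTheory.AlgebraicClassesHodgeTypeHolds
import Literature.AlgebraicGeometry.HodgeTheory.HodgeTypeExteriorProduct
import Literature.AlgebraicGeometry.HodgeTheory.LefschetzOneOneHolds
import Literature.AlgebraicGeometry.HodgeTheory.HardLefschetzNFoldHolds
import Literature.AlgebraicGeometry.HodgeTheory.SupportedClassesRationalProofs
import HarnessLib

/-!
# `HodgeBeyondAnchors` (stmt-HodgeConjecture-14054), line `andre-motivated-split`, stub (Δ):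
# the unconditional range of "diagonal pull-back preserves `Nᵖ H²ᵖ`"

Route `PadicSemiregularLift` of `HodgeConjecture`, crux `HodgeBeyondAnchors`. The registered stub
`stub_diagonalPullbackAlgebraic` of the line asks, for EVERY smooth projective complex `V` of
dimension `d` and EVERY `p`, that pull-back along the diagonal `Δ = (𝟙, 𝟙) : V ⟶ V ⊗ V` map
`algebraicClasses (V ⊗ V) p = Nᵖ H²ᵖ((V × V)(ℂ); ℂ)` into `algebraicClasses V p` (C. Voisin, *Hodge
Theory and Complex Algebraic Geometry II*, Prop. 9.21 (i) for the diagonal; W. Fulton, *Intersection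
Theory*, Cor. 19.2 (b)). On the tree's coniveau carrier this is EQUIVALENT to the unproved named facts
`Voisin2003_cupProduct_algebraicClasses` ⟺ `fulton1998_map_mem_algebraicClasses`
(`diagonalPullbackAlgebraic_iff_cupProduct`, file `…MotivatedSplit`), whose printed proofs are Chow's
moving lemma / deformation to the normal cone (the tree stops at the cone step,
`MovingLemmaExcessInduction`). This file records what IS unconditional, by a Hodge-theoretic detour
that needs no moving lemma:

* `map_mem_algebraicClasses_of_hodgeClasses_algebraic` — **the principle**: for ANY morphism
  `j : X ⟶ Y` of smooth projective complex varieties and any `p`, if every rational `(p,p)`-class of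
  `X` is algebraic (the cycle clause of the Hodge conjecture for `X` in codimension `p`), then
  `j^*(Nᵖ H²ᵖ(Y)) ⊆ Nᵖ H²ᵖ(X)`. Proof: `Nᵖ H²ᵖ(Y)` is the `ℂ`-span of its RATIONAL classes
  (`supportedClasses_eq_span_isRationalClass`, Grothendieck 1969 pp. 299–300 / universal
  coefficients), each of which is of Hodge type `(p,p)` (Voisin I Prop. 11.20,
  `isOfHodgeType_of_mem_algebraicClasses_of_isSmoothProjective`); `j^*` preserves rationality
  (`IsRationalClass.pullback`) and Hodge types (Voisin I §7.3.2,
  `IsOfHodgeType.map_of_isSmoothProjective`); conclude by the hypothesis and linearity.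
* `map_mem_algebraicClasses_one` — hence **`p = 1` for every `j`** (Lefschetz `(1,1)`,
  `lefschetzOneOne_rational_holds`);
* `map_mem_algebraicClasses_of_dim_le_add_one` — **`dim X ≤ p + 1` for every `j`** (hard Lefschetz
  `HardLefschetzNFold.mem_algebraicClasses_of_lt_holds` reduces codimension `p = dim X - 1` to
  codimension `1`; `p = 0`, `p ≥ dim X` are `algebraicClasses_eq_top_of_eq_zero_or_le`);
* `map_mem_algebraicClasses_of_dim_le_three` — **every `p` when `dim X ≤ 3`**
  (`hodgeClasses_algebraic_of_dim_le_three_holds`);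
* the diagonal instances `map_diagonal_mem_algebraicClasses_*` and the restricted forms of the stub
  `diagonalPullbackAlgebraic_of_le_one_or_dim_le_add_one` (`p ≤ 1 ∨ d ≤ p + 1`),
  `diagonalPullbackAlgebraic_of_dim_le_three` (`d ≤ 3`);
* `diagonalPullbackAlgebraic_of_middleRange` — the stub REDUCED to its open range `2 ≤ p ≤ d - 2`
  (the shape of a reshaped stub), and `diagonalPullbackAlgebraic_of_deepMiddle` — the stub from the
  Hodge conjecture in the deep middle `2 ≤ p`, `2p ≤ n` alone (hard Lefschetz folds `d < 2p` back);
* consistency: the full stub follows from the Hodge conjecture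
  (`diagonalPullbackAlgebraic_of_hodgeConjecture`), and at a fixed `V` from `HodgeConjectureFor d V`.

What is NOT here: the stub for `d ≥ 4`, `2 ≤ p ≤ d - 2` — there the detour needs the Hodge
conjecture for `V` in codimension `p` (or `d - p`), i.e. the deep middle the line is trying to
prove; the moving-lemma route is the named fact `Voisin2003_cupProduct_algebraicClasses`.

References: C. Voisin, *Hodge Theory and Complex Algebraic Geometry I* (2002), Prop. 11.20, §7.3.2,
Thm. 11.30, Thm. 6.25; *II* (2003), §9.2.4 Prop. 9.20, Prop. 9.21 (i); A. Grothendieck, *Hodge's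
general conjecture is false for trivial reasons*, Topology 8 (1969), §1 (pp. 299–300); W. Fulton,
*Intersection Theory* (1998), §19.2 Cor. 19.2 (b).
-/

set_option linter.dupNamespace false

noncomputable section

open CategoryTheory AlgebraicGeometry MonoidalCategory CartesianMonoidalCategory
open Literature.AlgebraicTopology.SingularHomology Literature.Geometry.Kaehler
open Literature.AlgebraicGeometry.Motives Literature.AlgebraicGeometry.HodgeTheory

namespace Summit.HodgeConjecture.HodgeConjecture.Theorems.HodgeBeyondAnchors

variable {m n d : ℕ} {Y X V : SchemeOver ℂ}

/-! ## The principle: pull-backs preserve `Nᵖ H²ᵖ` wherever the source satisfies Hodge in codimension `p` -/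

/-- **Pull-back along a morphism of smooth projective complex varieties maps `Nᵖ H²ᵖ(Y)` into
`Nᵖ H²ᵖ(X)` as soon as every rational `(p,p)`-class of the source `X` is algebraic.** `Nᵖ H²ᵖ(Y)` is
the complex span of its rational classes (`supportedClasses_eq_span_isRationalClass`), which are of
Hodge type `(p,p)` (Voisin I Prop. 11.20, `isOfHodgeType_of_mem_algebraicClasses_of_isSmoothProjective`);
`j^*` preserves rationality (`IsRationalClass.pullback`) and Hodge types (Voisin I §7.3.2,
`IsOfHodgeType.map_of_isSmoothProjective`); the hypothesis and `ℂ`-linearity of `j^*` conclude.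
[cite: VoisinHodgeI2002, §11.1.2 Prop. 11.20 and §7.3.2] [cite: GrothendieckTopology1969, pp. 299–300] -/
theorem map_mem_algebraicClasses_of_hodgeClasses_algebraic (hY : IsSmoothProjective m Y)
    (hX : IsSmoothProjective n X) (j : X ⟶ Y) {p : ℕ}
    (hHC : ∀ c' : complexBetti X (2 * p), IsRationalClass c' →
      IsOfHodgeType n X (2 * p) p p c' → c' ∈ algebraicClasses X p)
    {c : complexBetti Y (2 * p)} (hc : c ∈ algebraicClasses Y p) :
    complexBetti.map j (2 * p) c ∈ algebraicClasses X p := by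
  have hc' : c ∈ Submodule.span ℂ {c : complexBetti Y (2 * p) |
      IsRationalClass c ∧ c ∈ supportedClasses Y (2 * p) p} := by
    rw [← supportedClasses_eq_span_isRationalClass hY (2 * p) p]
    exact hc
  have hle : Submodule.span ℂ {c : complexBetti Y (2 * p) |
      IsRationalClass c ∧ c ∈ supportedClasses Y (2 * p) p} ≤
        (algebraicClasses X p).comap (complexBetti.map j (2 * p)).hom :=
    Submodule.span_le.2 fun c hc ↦ hHC _ (hc.1.pullback _)
      ((isOfHodgeType_of_mem_algebraicClasses_of_isSmoothProjective hY p hc.2).map_of_isSmoothProjective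
        hX hY j)
  exact hle hc'

/-- **`p = 1` for every morphism**: `j^*(N¹ H²(Y)) ⊆ N¹ H²(X)` for every `j : X ⟶ Y` between smooth
projective complex varieties — the principle fed with the Lefschetz theorem on `(1,1)`-classes for
`X` (`lefschetzOneOne_rational_holds`). [cite: VoisinHodgeI2002, Thm. 11.30 and Prop. 11.20] -/
theorem map_mem_algebraicClasses_one (hY : IsSmoothProjective m Y) (hX : IsSmoothProjective n X)
    (j : X ⟶ Y) {c : complexBetti Y (2 * 1)} (hc : c ∈ algebraicClasses Y 1) :
    complexBetti.map j (2 * 1) c ∈ algebraicClasses X 1 :=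
  map_mem_algebraicClasses_of_hodgeClasses_algebraic hY hX j (lefschetzOneOne_rational_holds hX) hc

/-- **`dim X ≤ p + 1` for every morphism**: `j^*(Nᵖ H²ᵖ(Y)) ⊆ Nᵖ H²ᵖ(X)` for every `j : X ⟶ Y`
between smooth projective complex varieties with `dim X ≤ p + 1`. The rational `(p,p)`-classes of
`X` are algebraic in this range: `p = 0` and `p ≥ dim X` because `Nᵖ H²ᵖ(X) = H²ᵖ(X)` there
(`algebraicClasses_eq_top_of_eq_zero_or_le`), `p = 1` by Lefschetz `(1,1)`, and `p = dim X - 1 ≥ 2`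
by hard Lefschetz (`HardLefschetzNFold.mem_algebraicClasses_of_lt_holds`: `c = Lᵖ⁻¹ c'` with `c'` a
rational `(1,1)`-class) and Lefschetz `(1,1)` again.
[cite: VoisinHodgeI2002, Thm. 6.25, Rem. 6.27 and Thm. 11.30] [cite: KerrPearlstein2011, §3.1] -/
theorem map_mem_algebraicClasses_of_dim_le_add_one (hY : IsSmoothProjective m Y)
    (hX : IsSmoothProjective n X) {p : ℕ} (hnp : n ≤ p + 1) (j : X ⟶ Y)
    {c : complexBetti Y (2 * p)} (hc : c ∈ algebraicClasses Y p) :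
    complexBetti.map j (2 * p) c ∈ algebraicClasses X p := by
  refine map_mem_algebraicClasses_of_hodgeClasses_algebraic hY hX j (fun c' hc' hpp ↦ ?_) hc
  rcases (show (p = 0 ∨ n ≤ p) ∨ (p = 1) ∨ (2 ≤ p ∧ n = p + 1) by omega) with h | rfl | ⟨hp2, rfl⟩
  · rw [algebraicClasses_eq_top_of_eq_zero_or_le hX h]
    exact Submodule.mem_top
  · exact lefschetzOneOne_rational_holds hX c' hc' hpp
  · refine HardLefschetzNFold.mem_algebraicClasses_of_lt_holds hX (by omega) ?_ c' hc' hpp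
    rw [Nat.add_sub_cancel_left]
    exact lefschetzOneOne_rational_holds hX

/-- **Every `p` when `dim X ≤ 3`**: `j^*(Nᵖ H²ᵖ(Y)) ⊆ Nᵖ H²ᵖ(X)` for every `j : X ⟶ Y` between
smooth projective complex varieties with `dim X ≤ 3` — the principle fed with the Hodge conjecture
for curves, surfaces and threefolds (`hodgeClasses_algebraic_of_dim_le_three_holds`, Voisin II
proof of Prop. 10.26). [cite: VoisinHodgeII2003, §10.2.3 proof of Prop. 10.26]
[cite: VoisinHodgeI2002, Thm. 6.25 and Thm. 11.30] -/
theorem map_mem_algebraicClasses_of_dim_le_three (hY : IsSmoothProjective m Y)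
    (hX : IsSmoothProjective n X) (hn : n ≤ 3) (j : X ⟶ Y) (p : ℕ)
    {c : complexBetti Y (2 * p)} (hc : c ∈ algebraicClasses Y p) :
    complexBetti.map j (2 * p) c ∈ algebraicClasses X p :=
  map_mem_algebraicClasses_of_hodgeClasses_algebraic hY hX j
    (hodgeClasses_algebraic_of_dim_le_three_holds hn hX p) hc

/-- **Every `p` when the Hodge conjecture holds for the source**: `j^*(Nᵖ H²ᵖ(Y)) ⊆ Nᵖ H²ᵖ(X)` for
every `j : X ⟶ Y` of smooth projective complex varieties with `HodgeConjectureFor n X`.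
[cite: VoisinHodgeI2002, §11.1.2 Prop. 11.20 and §7.3.2] -/
theorem map_mem_algebraicClasses_of_hodgeConjectureFor (hY : IsSmoothProjective m Y)
    (hX : IsSmoothProjective n X) (hHC : HodgeConjectureFor n X) (j : X ⟶ Y) (p : ℕ)
    {c : complexBetti Y (2 * p)} (hc : c ∈ algebraicClasses Y p) :
    complexBetti.map j (2 * p) c ∈ algebraicClasses X p :=
  map_mem_algebraicClasses_of_hodgeClasses_algebraic hY hX j (hHC.2 p) hc

/-! ## The diagonal `Δ = (𝟙, 𝟙) : V ⟶ V ⊗ V` -/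

/-- (Δ) in codimension `p` for `V` follows from "rational `(p,p)`-classes of `V` are algebraic"
(the principle at `j = Δ`, `V ⊗ V` smooth projective of dimension `d + d`,
`IsSmoothProjective.tensor_holds`). [cite: VoisinHodgeI2002, §11.1.2 Prop. 11.20 and §7.3.2]
[cite: VoisinHodgeII2003, §9.2.4 Prop. 9.21 (i)] -/
theorem map_diagonal_mem_algebraicClasses_of_hodgeClasses_algebraic (hV : IsSmoothProjective d V)
    {p : ℕ} (hHC : ∀ c' : complexBetti V (2 * p), IsRationalClass c' →
      IsOfHodgeType d V (2 * p) p p c' → c' ∈ algebraicClasses V p)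
    {c : complexBetti (V ⊗ V) (2 * p)} (hc : c ∈ algebraicClasses (V ⊗ V) p) :
    complexBetti.map (lift (𝟙 V) (𝟙 V)) (2 * p) c ∈ algebraicClasses V p :=
  map_mem_algebraicClasses_of_hodgeClasses_algebraic (IsSmoothProjective.tensor_holds hV hV) hV _
    hHC hc

/-- (Δ) in the trivial range `p = 0 ∨ d ≤ p`, for every class (algebraic or not):
`Nᵖ H²ᵖ(V) = H²ᵖ(V)` there (`map_mem_algebraicClasses_of_eq_zero_or_dim_le`).
[cite: VoisinHodgeI2002, §11.1.2 and §11.3] -/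
theorem map_diagonal_mem_algebraicClasses_of_eq_zero_or_dim_le (hV : IsSmoothProjective d V)
    {p : ℕ} (hp : p = 0 ∨ d ≤ p) (c : complexBetti (V ⊗ V) (2 * p)) :
    complexBetti.map (lift (𝟙 V) (𝟙 V)) (2 * p) c ∈ algebraicClasses V p :=
  map_mem_algebraicClasses_of_eq_zero_or_dim_le hV (lift (𝟙 V) (𝟙 V)) hp c

/-- (Δ) in codimension `p = 1` for every smooth projective `V` (Lefschetz `(1,1)`).
[cite: VoisinHodgeI2002, Thm. 11.30 and Prop. 11.20] [cite: VoisinHodgeII2003, §9.2.4 Prop. 9.21 (i)] -/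
theorem map_diagonal_mem_algebraicClasses_one (hV : IsSmoothProjective d V)
    {c : complexBetti (V ⊗ V) (2 * 1)} (hc : c ∈ algebraicClasses (V ⊗ V) 1) :
    complexBetti.map (lift (𝟙 V) (𝟙 V)) (2 * 1) c ∈ algebraicClasses V 1 :=
  map_mem_algebraicClasses_one (IsSmoothProjective.tensor_holds hV hV) hV _ hc

/-- (Δ) in codimension `p ≥ d - 1`, i.e. `d ≤ p + 1`, for every smooth projective `V` of dimension
`d` (hard Lefschetz + Lefschetz `(1,1)`; trivial for `p ≥ d`).
[cite: VoisinHodgeI2002, Thm. 6.25, Rem. 6.27 and Thm. 11.30] [cite: VoisinHodgeII2003, §9.2.4 Prop. 9.21 (i)] -/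
theorem map_diagonal_mem_algebraicClasses_of_dim_le_add_one (hV : IsSmoothProjective d V)
    {p : ℕ} (hdp : d ≤ p + 1) {c : complexBetti (V ⊗ V) (2 * p)}
    (hc : c ∈ algebraicClasses (V ⊗ V) p) :
    complexBetti.map (lift (𝟙 V) (𝟙 V)) (2 * p) c ∈ algebraicClasses V p :=
  map_mem_algebraicClasses_of_dim_le_add_one (IsSmoothProjective.tensor_holds hV hV) hV hdp _ hc

/-- (Δ) in every codimension for smooth projective `V` of dimension `d ≤ 3` (the Hodge conjecture
holds for `V`). [cite: VoisinHodgeII2003, §10.2.3 proof of Prop. 10.26 and §9.2.4 Prop. 9.21 (i)] -/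
theorem map_diagonal_mem_algebraicClasses_of_dim_le_three (hV : IsSmoothProjective d V)
    (hd : d ≤ 3) (p : ℕ) {c : complexBetti (V ⊗ V) (2 * p)}
    (hc : c ∈ algebraicClasses (V ⊗ V) p) :
    complexBetti.map (lift (𝟙 V) (𝟙 V)) (2 * p) c ∈ algebraicClasses V p :=
  map_mem_algebraicClasses_of_dim_le_three (IsSmoothProjective.tensor_holds hV hV) hV hd _ p hc

/-! ## Restricted forms of the registered stub (same binders, one extra range hypothesis) -/

/-- **(Δ) UNCONDITIONALLY in the codimension range `p ≤ 1 ∨ d ≤ p + 1`** — the registered stub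
`stub_diagonalPullbackAlgebraic` with the single extra hypothesis `p ≤ 1 ∨ d ≤ p + 1` (all of
`p = 0`, `p = 1`, `p = d - 1`, `p ≥ d`). [cite: VoisinHodgeII2003, §9.2.4 Prop. 9.21 (i)]
[cite: VoisinHodgeI2002, Thm. 6.25, Thm. 11.30 and Prop. 11.20] -/
theorem diagonalPullbackAlgebraic_of_le_one_or_dim_le_add_one :
    ∀ ⦃d : ℕ⦄ ⦃V : SchemeOver ℂ⦄, IsSmoothProjective d V → ∀ (p : ℕ), (p ≤ 1 ∨ d ≤ p + 1) →
      ∀ ⦃c : complexBetti (V ⊗ V) (2 * p)⦄, c ∈ algebraicClasses (V ⊗ V) p →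
        complexBetti.map (lift (𝟙 V) (𝟙 V)) (2 * p) c ∈ algebraicClasses V p := by
  intro d V hV p hp c hc
  rcases hp with hp | hp
  · rcases (show p = 0 ∨ p = 1 by omega) with rfl | rfl
    · exact map_diagonal_mem_algebraicClasses_of_eq_zero_or_dim_le hV (Or.inl rfl) c
    · exact map_diagonal_mem_algebraicClasses_one hV hc
  · exact map_diagonal_mem_algebraicClasses_of_dim_le_add_one hV hp hc

/-- **(Δ) UNCONDITIONALLY for `dim V ≤ 3`** — the registered stub `stub_diagonalPullbackAlgebraic`
with the single extra hypothesis `d ≤ 3` (every `p`). [cite: VoisinHodgeII2003, §9.2.4 Prop. 9.21 (i) and §10.2.3 proof of Prop. 10.26] -/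
theorem diagonalPullbackAlgebraic_of_dim_le_three :
    ∀ ⦃d : ℕ⦄ ⦃V : SchemeOver ℂ⦄, IsSmoothProjective d V → d ≤ 3 → ∀ (p : ℕ)
      ⦃c : complexBetti (V ⊗ V) (2 * p)⦄, c ∈ algebraicClasses (V ⊗ V) p →
        complexBetti.map (lift (𝟙 V) (𝟙 V)) (2 * p) c ∈ algebraicClasses V p :=
  fun _ _ hV hd p _ hc ↦ map_diagonal_mem_algebraicClasses_of_dim_le_three hV hd p hc

/-- **The registered stub REDUCED to its open range `2 ≤ p ≤ d - 2`** (so `d ≥ 4`): if diagonal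
pull-back preserves `Nᵖ H²ᵖ` for every smooth projective `V` of dimension `d ≥ p + 2` and every
`2 ≤ p`, then it does so for every `d`, `p` (the complement `p ≤ 1 ∨ d ≤ p + 1` is
`diagonalPullbackAlgebraic_of_le_one_or_dim_le_add_one`). This is the shape of a reshaped stub.
[cite: VoisinHodgeII2003, §9.2.4 Prop. 9.21 (i)] -/
theorem diagonalPullbackAlgebraic_of_middleRange
    (h : ∀ ⦃d : ℕ⦄ ⦃V : SchemeOver ℂ⦄, IsSmoothProjective d V → ∀ (p : ℕ), 2 ≤ p → p + 2 ≤ d →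
      ∀ ⦃c : complexBetti (V ⊗ V) (2 * p)⦄, c ∈ algebraicClasses (V ⊗ V) p →
        complexBetti.map (lift (𝟙 V) (𝟙 V)) (2 * p) c ∈ algebraicClasses V p) :
    ∀ ⦃d : ℕ⦄ ⦃V : SchemeOver ℂ⦄, IsSmoothProjective d V → ∀ (p : ℕ)
      ⦃c : complexBetti (V ⊗ V) (2 * p)⦄, c ∈ algebraicClasses (V ⊗ V) p →
        complexBetti.map (lift (𝟙 V) (𝟙 V)) (2 * p) c ∈ algebraicClasses V p := by
  intro d V hV p c hc
  rcases (show (p ≤ 1 ∨ d ≤ p + 1) ∨ (2 ≤ p ∧ p + 2 ≤ d) by omega) with hp | ⟨hp2, hpd⟩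
  · exact diagonalPullbackAlgebraic_of_le_one_or_dim_le_add_one hV p hp hc
  · exact h hV p hp2 hpd hc

/-- **The registered stub from the Hodge conjecture IN THE DEEP MIDDLE only** (`2 ≤ p`, `2p ≤ n`,
rational `(p,p)`-classes algebraic — the range to which the line's glue reduces the summit): for a
given `V` and `p`, the rational `(p,p)`-classes of `V` are algebraic either trivially (`p = 0`,
`p ≥ d`), by Lefschetz `(1,1)` (`p = 1`), by the hypothesis (`2 ≤ p`, `2p ≤ d`), or by hard
Lefschetz (`d < 2p`, `HardLefschetzNFold.mem_algebraicClasses_of_lt_holds`) from codimension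
`d - p`, which is `1` or again in the deep middle; then the principle at `j = Δ`. So on this
carrier the open range of (Δ) is implied by the conclusion of the line, never the other way.
[cite: VoisinHodgeI2002, Thm. 6.25, Rem. 6.27, Thm. 11.30 and Prop. 11.20] [cite: KerrPearlstein2011, §3.1] -/
theorem diagonalPullbackAlgebraic_of_deepMiddle
    (hDM : ∀ ⦃n : ℕ⦄ ⦃X : SchemeOver ℂ⦄, IsSmoothProjective n X →
      ∀ p : ℕ, 2 ≤ p → 2 * p ≤ n →
        ∀ c : complexBetti X (2 * p), IsRationalClass c → IsOfHodgeType n X (2 * p) p p c →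
          c ∈ algebraicClasses X p) :
    ∀ ⦃d : ℕ⦄ ⦃V : SchemeOver ℂ⦄, IsSmoothProjective d V → ∀ (p : ℕ)
      ⦃c : complexBetti (V ⊗ V) (2 * p)⦄, c ∈ algebraicClasses (V ⊗ V) p →
        complexBetti.map (lift (𝟙 V) (𝟙 V)) (2 * p) c ∈ algebraicClasses V p := by
  intro d V hV p c hc
  refine map_diagonal_mem_algebraicClasses_of_hodgeClasses_algebraic hV (fun c' hc' hpp ↦ ?_) hc
  rcases (show (p = 0 ∨ d ≤ p) ∨ p = 1 ∨ (2 ≤ p ∧ 2 * p ≤ d) ∨ (2 ≤ p ∧ d < 2 * p ∧ p < d) by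
    omega) with h | rfl | ⟨hp2, hpd⟩ | ⟨-, hdp, hpd⟩
  · rw [algebraicClasses_eq_top_of_eq_zero_or_le hV h]
    exact Submodule.mem_top
  · exact lefschetzOneOne_rational_holds hV c' hc' hpp
  · exact hDM hV p hp2 hpd c' hc' hpp
  · refine HardLefschetzNFold.mem_algebraicClasses_of_lt_holds hV hdp ?_ c' hc' hpp
    generalize hk : d - p = k
    intro c'' hc'' hpp''
    obtain rfl | ⟨h2, h3⟩ : k = 1 ∨ (2 ≤ k ∧ 2 * k ≤ d) := by omega
    · exact lefschetzOneOne_rational_holds hV c'' hc'' hpp''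
    · exact hDM hV k h2 h3 c'' hc'' hpp''

/-! ## Consistency: the stub is a consequence of the summit -/

/-- **(Δ) at `V` from the Hodge conjecture for `V`** (so the stub, variety by variety, is a
fragment of the summit and not refutable short of refuting it).
[cite: VoisinHodgeI2002, §11.1.2 Prop. 11.20 and §7.3.2] -/
theorem map_diagonal_mem_algebraicClasses_of_hodgeConjectureFor (hV : IsSmoothProjective d V)
    (hHC : HodgeConjectureFor d V) (p : ℕ) {c : complexBetti (V ⊗ V) (2 * p)}
    (hc : c ∈ algebraicClasses (V ⊗ V) p) :
    complexBetti.map (lift (𝟙 V) (𝟙 V)) (2 * p) c ∈ algebraicClasses V p :=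
  map_diagonal_mem_algebraicClasses_of_hodgeClasses_algebraic hV (hHC.2 p) hc

/-- **(Δ), verbatim the registered stub, from the Hodge conjecture** (consistency of the support
child of the split with the summit; compare `hodgeClassesMotivated_of_hodgeConjecture` for (HM)).
[cite: VoisinHodgeI2002, §11.1.2 Prop. 11.20 and §7.3.2] [cite: VoisinHodgeII2003, §9.2.4 Prop. 9.21 (i)] -/
theorem diagonalPullbackAlgebraic_of_hodgeConjecture (h : _root_.HodgeConjecture) :
    ∀ ⦃d : ℕ⦄ ⦃V : SchemeOver ℂ⦄, IsSmoothProjective d V → ∀ (p : ℕ)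
      ⦃c : complexBetti (V ⊗ V) (2 * p)⦄, c ∈ algebraicClasses (V ⊗ V) p →
        complexBetti.map (lift (𝟙 V) (𝟙 V)) (2 * p) c ∈ algebraicClasses V p :=
  fun _ _ hV p _ hc ↦ map_diagonal_mem_algebraicClasses_of_hodgeConjectureFor hV (h hV) p hc

/-- **Fulton's Cor. 19.2 (b) on the coniveau carrier from the Hodge conjecture** (the named fact
`fulton1998_map_mem_algebraicClasses`, hence also `Voisin2003_cupProduct_algebraicClasses`, is a
consequence of the summit: pull back to a source satisfying Hodge in every codimension).
[cite: Fulton1998, §19.2 Cor. 19.2 (b)] [cite: VoisinHodgeI2002, §11.1.2 Prop. 11.20 and §7.3.2] -/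
theorem fulton1998_map_mem_algebraicClasses_of_hodgeConjecture (h : _root_.HodgeConjecture) :
    fulton1998_map_mem_algebraicClasses :=
  fun _ _ _ _ j hY hX p _ hc ↦ map_mem_algebraicClasses_of_hodgeConjectureFor hY hX (h hX) j p hc

end Summit.HodgeConjecture.HodgeConjecture.Theorems.HodgeBeyondAnchors

end
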